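import Literature.NumberTheory.EllipticCurves.CanonicalPAdicHeightCycExistenceHolds
import Literature.NumberTheory.EllipticCurves.CanonicalPAdicHeightAdmissibleKProofs
import Mathlib.Data.Int.WithZero
import HarnessLib

/-!
# THE canonical cyclotomic `p`-adic height over a number field is UNIQUE: admissible multiples for
# the cyclotomic local conditions, `∃!`, and `Aut(H/ℚ)`-invariance of every canonical datum (proofs only)

Topic `Literature/NumberTheory/EllipticCurves` (trunk T-NT-EC); PROOFS file (theorems only, no
definitions, no named facts). Companion of `CanonicalPAdicHeightCycExistenceHolds.lean`
(`WeierstrassCurve.exists_isCanonicalCyc_holds`: existence of a canonical cyclotomic datum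
`PAdicHeightDataK.IsCanonicalCyc` on `E(H)` at every good ordinary prime). The spec file
`CanonicalPAdicHeightCyc.lean` proves uniqueness of the canonical datum
(`PAdicHeightDataK.isCanonicalCyc_unique`) GIVEN that every non-torsion point of `E(H)` has an
admissible multiple; this file supplies that hypothesis and draws the conclusions:

* `exists_admissibleCyc_nsmul` — for `W ⊗ H` globally minimal, every non-torsion `P ∈ E(H)` has a
  multiple `m•P` (`m ≥ 1`) satisfying `IsAdmissibleCyc p H`: non-singular reduction at every finite
  place and `E₁` at the places dividing `Δ` come from the tree theorem `exists_admissibleK_nsmul_holds`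
  (its place-wise half; Silverman AEC VII.6.1–6.2, VII.2.1); `E₁` at every `w ∋ p` from the
  finite-index kernels of reduction `exists_finiteIndex_one_lt_valuation`; the sigma disc
  `ord_w(z^{p−1}) > ord_w p` by the contraction of `p`-power multiples in the chart at `O`
  (`val_zCoord_pow_smul_le_mul_pow`, read through the rank-one form
  `toNNReal ∘ w.valuation` of the `w`-adic valuation, Mathlib `WithZeroMulInt.toNNReal`);
* `existsUnique_isCanonicalCyc_of_pair`, `WeierstrassCurve.existsUnique_isCanonicalCyc` — `∃!`;
* `WeierstrassCurve.PAdicHeightDataK.IsCanonicalCyc.pairing_pointGalHom` — EVERY canonical datum is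
  `Aut(H/ℚ)`-invariant (it is the invariant one of the existence theorem).

## References

* B. Mazur, W. Stein, J. Tate, Doc. Math. Extra Vol. Coates (2006), §2.6 (admissible multiples «replacing
  α, β by m·α, n·β»), §2.7–2.8. [MazurSteinTate2006]
* J. H. Silverman, *The Arithmetic of Elliptic Curves*, 2nd ed. (2009), VII.2.1–2.2, VII.6.1–6.3,
  Prop. IV.3.2. [SilvermanAEC2009]
* W. Stein, C. Wuthrich, Math. Comp. 82 (2013), §4 (sigma disc). [SteinWuthrich2013]
-/

noncomputable section

open scoped Classical NNReal
open IsDedekindDomain NumberField WeierstrassCurve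

namespace Literature.NumberTheory.EllipticCurves

/-! ### Contraction into the first-order disc (any rank-one valued field) -/

section Generic

open FormalGroupChart

variable {F : Type*} [Field F] {w : Valuation F ℝ≥0} {V : WeierstrassCurve F}
  [hV : V.IsIntegral w.integer]

/-- **Large `p`-power multiples of a point of `E₁` enter the first-order disc `|z| < |p|`** (for
`0 < |p| < 1`): `|z(pʲ·Q)| ≤ max(|p|, |z(Q)|)ʲ·|z(Q)| → 0`. [cite: SilvermanAEC2009, Prop. IV.3.2 with Prop. VII.2.2] -/
theorem exists_forall_val_zCoord_pow_smul_lt {Q : V.toAffine.Point} (hQ : Q ∈ kernel w V) {p : ℕ}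
    (hp0 : 0 < w (p : F)) (hp1 : w (p : F) < 1) :
    ∃ k : ℕ, ∀ j : ℕ, k ≤ j → w ((p ^ j) • Q).zCoord < w (p : F) := by
  set μ : ℝ≥0 := max (w (p : F)) (w Q.zCoord) with hμ
  have hμ1 : μ < 1 := max_lt hp1 (val_zCoord_lt_one hQ)
  obtain ⟨k, hk⟩ := exists_pow_lt_of_lt_one (NNReal.coe_pos.mpr hp0) (NNReal.coe_lt_one.mpr hμ1)
  refine ⟨k, fun j hj => ?_⟩
  calc w ((p ^ j) • Q).zCoord ≤ μ ^ j * w Q.zCoord := val_zCoord_pow_smul_le_mul_pow hQ p j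
    _ ≤ μ ^ j * 1 := mul_le_mul' le_rfl (val_zCoord_lt_one hQ).le
    _ ≤ μ ^ k := by rw [mul_one]; exact pow_le_pow_right_of_le_one' hμ1.le hj
    _ < w (p : F) := by exact_mod_cast hk

end Generic

/-! ### The rank-one form of a finite place of a number field -/

section Place

variable (H : Type) [Field H] [NumberField H]

/-- **A rank-one (`ℝ≥0`-valued) valuation equivalent to the `w`-adic valuation** of a number field:
`u = 2^{ord}` composed with `w.valuation` (Mathlib `WithZeroMulInt.toNNReal`, strictly monotone), so
`u x < u y ↔ w(x) < w(y)`. (Any base `> 1` serves; the chart calculus of `FormalGroupChart.lean` wants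
the value group `ℝ≥0`.) [folklore] -/
private theorem exists_valuation_nnreal (w : HeightOneSpectrum (𝓞 H)) :
    ∃ u : Valuation H ℝ≥0, ∀ x y : H, u x < u y ↔ w.valuation H x < w.valuation H y := by
  have h2 : (1 : ℝ≥0) < 2 := one_lt_two
  refine ⟨(w.valuation H).map (WithZeroMulInt.toNNReal (ne_zero_of_lt h2))
    (WithZeroMulInt.toNNReal_strictMono h2).monotone, fun x y => ?_⟩
  exact (WithZeroMulInt.toNNReal_strictMono h2).lt_iff_lt

end Place

/-! ### Admissible multiples for the cyclotomic local conditions -/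

section Admissible

variable (W : WeierstrassCurve ℚ) [W.IsElliptic] (p : ℕ) [Fact p.Prime]
  (H : Type) [Field H] [NumberField H] [(W.baseChange H).IsGloballyMinimal]

/-- **Admissible multiples over `H` for the cyclotomic height.** For `W ⊗ H` globally minimal, a
prime `p` and a non-torsion `P ∈ E(H)`, some multiple `m•P` (`m ≥ 1`) is admissible for
`IsAdmissibleCyc p H`: it reduces non-singularly at every finite place, lies in `E₁` at every prime
`w ∋ p` (`ord_w x < 0`), and its parameter is in the sigma disc `ord_w(z^{p−1}) > ord_w p` there. Proof:
the place-wise half of the tree theorem `exists_admissibleK_nsmul_holds` (non-singular reduction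
everywhere), the finite-index kernels of reduction at the finitely many `w ∋ p`
(`exists_finiteIndex_one_lt_valuation`), and the contraction of `p`-power multiples in the chart at `O`
(`exists_forall_val_zCoord_pow_smul_lt` for the rank-one form of `w`).
[cite: MazurSteinTate2006, §2.6 (PDF p. 10 L7–17)] [cite: SilvermanAEC2009, Cor. VII.6.2, Prop. VII.2.1–2.2 and Prop. IV.3.2] -/
theorem exists_admissibleCyc_nsmul (P : (W.baseChange H).toAffine.Point) (hP : ¬ IsOfFinAddOrder P) :
    ∃ m : ℕ, m ≠ 0 ∧ W.IsAdmissibleCyc p H (m • P) := by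
  have hp : p.Prime := Fact.out
  haveI hWint : W.IsIntegral ℤ := isIntegral_int_of_isIntegral_baseChange W H
  haveI : (W.baseChange H).IsElliptic := by rw [baseChange]; infer_instance
  -- Step 1: non-singular reduction everywhere (place-wise half of the `K`-admissible multiple)
  obtain ⟨m₀, hm₀, hK⟩ := exists_admissibleK_nsmul_holds W H p P hP
  set Q₀ : (W.baseChange H).toAffine.Point := m₀ • P with hQ₀def
  have hQ₀nt : ¬ IsOfFinAddOrder Q₀ := hK.1
  have hE₀ : ∀ v : HeightOneSpectrum (𝓞 H), Q₀ ∈ nonsingularReductionSubgroupAtPlace W H v := by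
    intro v
    have hloc := hK.2
    rcases hQ : Q₀ with _ | ⟨x, y, h⟩
    · exact AddSubgroup.zero_mem _
    · rw [hQ] at hloc
      exact (some_mem_nonsingularReductionSubgroupAtPlace_iff v h).mpr (hloc.2 v)
  -- the coefficients of `W ⊗ H` are algebraic integers
  obtain ⟨Wz, hWz⟩ := hWint.integral
  have hcoe : ∀ n : ℤ, algebraMap ℚ H (algebraMap ℤ ℚ n) = algebraMap (𝓞 H) H n := by simp
  have hc : ∀ u : HeightOneSpectrum (𝓞 H), u.valuation H (W.baseChange H).a₁ ≤ 1 ∧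
      u.valuation H (W.baseChange H).a₂ ≤ 1 ∧ u.valuation H (W.baseChange H).a₃ ≤ 1 ∧
      u.valuation H (W.baseChange H).a₄ ≤ 1 ∧ u.valuation H (W.baseChange H).a₆ ≤ 1 := by
    intro u
    simp only [hWz, baseChange, map_a₁, map_a₂, map_a₃, map_a₄, map_a₆, hcoe]
    exact ⟨u.valuation_le_one _, u.valuation_le_one _, u.valuation_le_one _,
      u.valuation_le_one _, u.valuation_le_one _⟩
  -- Step 2: `E₁` at the finitely many primes `w ∋ p`
  have hp0 : ((p : ℕ) : 𝓞 H) ≠ 0 := by exact_mod_cast hp.ne_zero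
  set S := {w : HeightOneSpectrum (𝓞 H) | w.asIdeal ∣ Ideal.span {((p : ℕ) : 𝓞 H)}} with hS
  haveI : Finite S :=
    (Ideal.finite_factors (by simpa [Ideal.span_singleton_eq_bot] using hp0)).to_subtype
  haveI : Fintype S := Fintype.ofFinite S
  have hSmem : ∀ w : HeightOneSpectrum (𝓞 H), ((p : ℕ) : 𝓞 H) ∈ w.asIdeal → w ∈ S := fun w hw =>
    Ideal.dvd_span_singleton.mpr hw
  choose Hw hHw hHw' using fun w : HeightOneSpectrum (𝓞 H) =>
    exists_finiteIndex_one_lt_valuation w (W.baseChange H) (hc w).1 (hc w).2.1 (hc w).2.2.1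
      (hc w).2.2.2.1 (hc w).2.2.2.2
  set G₁ : AddSubgroup (W.baseChange H).toAffine.Point := ⨅ w : S, Hw w with hG₁
  haveI hG₁fin : G₁.FiniteIndex := AddSubgroup.finiteIndex_iInf fun w => hHw w
  have hn : G₁.index ≠ 0 := hG₁fin.index_ne_zero
  set Q₁ : (W.baseChange H).toAffine.Point := G₁.index • Q₀ with hQ₁def
  have hQ₁G : Q₁ ∈ G₁ := G₁.nsmul_index_mem Q₀
  have hQ₁nt : ¬ IsOfFinAddOrder Q₁ := fun h => hQ₀nt (h.of_nsmul hn)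
  have hQ₁E₀ : ∀ v, Q₁ ∈ nonsingularReductionSubgroupAtPlace W H v := fun v =>
    (nonsingularReductionSubgroupAtPlace W H v).nsmul_mem (hE₀ v) _
  -- Step 3: the sigma disc at every `w ∈ S`, by contraction of `p`-power multiples
  have hdisc : ∀ w : S, ∃ k : ℕ, ∀ j : ℕ, k ≤ j →
      ∀ {x y : H} (h : (W.baseChange H).toAffine.Nonsingular x y),
        (p ^ j) • Q₁ = .some x y h →
          1 < w.1.valuation H x ∧ w.1.valuation H ((-x / y) ^ (p - 1)) < w.1.valuation H (p : H) := by
    intro w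
    have hwp : ((p : ℕ) : 𝓞 H) ∈ w.1.asIdeal := Ideal.dvd_span_singleton.mp w.2
    obtain ⟨u, hu⟩ := exists_valuation_nnreal H w.1
    have hu1 : ∀ x : H, u x < 1 ↔ w.1.valuation H x < 1 := fun x => by
      simpa only [map_one] using hu x 1
    have hu1' : ∀ x : H, 1 < u x ↔ 1 < w.1.valuation H x := fun x => by
      simpa only [map_one] using hu 1 x
    have hule : ∀ x : H, u x ≤ 1 ↔ w.1.valuation H x ≤ 1 := fun x => by
      rw [← not_lt, ← not_lt, hu1']
    haveI : (W.baseChange H).IsIntegral u.integer := by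
      have hc' := valuation_coeff_baseChange_le_one W H u fun m =>
        (hule _).mpr (heightOneSpectrum_valuation_intCast_le_one H w.1 m)
      exact ⟨⟨⟨(W.baseChange H).a₁, hc'.1⟩, ⟨(W.baseChange H).a₂, hc'.2.1⟩, ⟨(W.baseChange H).a₃, hc'.2.2.1⟩,
        ⟨(W.baseChange H).a₄, hc'.2.2.2.1⟩, ⟨(W.baseChange H).a₆, hc'.2.2.2.2⟩⟩, rfl⟩
    -- `Q₁ ∈ E₁` for `u`
    have hQ₁ker : Q₁ ∈ FormalGroupChart.kernel u (W.baseChange H) := by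
      intro x y h he
      exact (hu1' x).mpr (hHw' w.1 h (by rw [← he]; exact AddSubgroup.mem_iInf.mp hQ₁G w))
    -- `0 < u p < 1`
    have hp_lt : u (p : H) < 1 := by
      rw [hu1, show (p : H) = algebraMap (𝓞 H) H ((p : ℕ) : 𝓞 H) by rw [map_natCast]]
      exact (IsDedekindDomain.HeightOneSpectrum.valuation_lt_one_iff_mem (K := H) w.1 _).mpr hwp
    have hp_pos : 0 < u (p : H) := by
      rw [Valuation.pos_iff]; exact_mod_cast hp.ne_zero
    obtain ⟨k, hk⟩ := exists_forall_val_zCoord_pow_smul_lt hQ₁ker hp_pos hp_lt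
    refine ⟨k, fun j hj x y h he => ?_⟩
    have hmem : (p ^ j) • Q₁ ∈ FormalGroupChart.kernel u (W.baseChange H) :=
      (FormalGroupChart.kernel u (W.baseChange H)).nsmul_mem hQ₁ker _
    have hz : u (-x / y) < u (p : H) := by
      have := hk j hj
      rwa [he, WeierstrassCurve.Affine.Point.zCoord_some] at this
    refine ⟨(hu1' x).mp ?_, (hu _ _).mp ?_⟩
    · rw [he] at hmem
      exact (FormalGroupChart.some_mem_kernel_iff h).mp hmem
    · rw [map_pow]
      have hp1 : p - 1 ≠ 0 := by have := hp.two_le; omega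
      exact lt_of_le_of_lt (pow_le_of_le_one zero_le (hz.le.trans hp_lt.le) hp1) hz
  choose k hk using hdisc
  set K : ℕ := Finset.univ.sup k with hKdef
  -- Step 4: the admissible multiple `p^K • Q₁ = (p^K * G₁.index * m₀) • P`
  refine ⟨p ^ K * (G₁.index * m₀), mul_ne_zero (pow_ne_zero K hp.ne_zero) (mul_ne_zero hn hm₀), ?_⟩
  have hQ₂ : (p ^ K * (G₁.index * m₀)) • P = (p ^ K) • Q₁ := by
    rw [hQ₁def, hQ₀def, smul_smul, smul_smul, mul_assoc]
  rw [hQ₂]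
  have hQ₂nt : ¬ IsOfFinAddOrder ((p ^ K) • Q₁) := fun h =>
    hQ₁nt (h.of_nsmul (pow_ne_zero K hp.ne_zero))
  refine ⟨hQ₂nt, ?_⟩
  rcases hQ : (p ^ K) • Q₁ with _ | ⟨x, y, h⟩
  · exact (hQ₂nt (by rw [hQ]; exact IsOfFinAddOrder.zero)).elim
  refine (satisfiesLocalConditionsCyc_some h).mpr ⟨fun w hw => ?_, fun v => ?_⟩
  · exact hk ⟨w, hSmem w hw⟩ K (Finset.le_sup (Finset.mem_univ _)) h hQ
  · have hmem := (nonsingularReductionSubgroupAtPlace W H v).nsmul_mem (hQ₁E₀ v) (p ^ K)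
    rw [hQ] at hmem
    exact (some_mem_nonsingularReductionSubgroupAtPlace_iff v h).mp hmem

/-- **THE canonical cyclotomic `p`-adic height datum is UNIQUE, given a sigma-squared pair of
`W ⊗ ℚ_p`** (`W ⊗ H` globally minimal): `∃! DH : PAdicHeightDataK W p H, DH.IsCanonicalCyc` —
existence by `exists_isCanonicalCyc_of_pair`, uniqueness by `isCanonicalCyc_unique` with the admissible
multiples of `exists_admissibleCyc_nsmul`. [cite: MazurSteinTate2006, §2.6–2.8 (PDF p. 10 L7 – p. 11 L58)] -/
theorem existsUnique_isCanonicalCyc_of_pair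
    (hpair : ∃ Sq : PowerSeries ℚ_[p], ∃ c : ℚ_[p], (W.baseChange ℚ_[p]).IsMazurTateSigmaSqPair Sq c) :
    ∃! DH : PAdicHeightDataK W p H, DH.IsCanonicalCyc := by
  haveI : W.IsIntegral ℤ := isIntegral_int_of_isIntegral_baseChange W H
  obtain ⟨DH, hDH, -⟩ := exists_isCanonicalCyc_of_pair W p H hpair
  exact ⟨DH, hDH, fun D hD =>
    PAdicHeightDataK.isCanonicalCyc_unique (fun P hP => exists_admissibleCyc_nsmul W p H P hP) hD hDH⟩

end Admissible

end Literature.NumberTheory.EllipticCurves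

namespace WeierstrassCurve

open Literature.NumberTheory.EllipticCurves

/-- **THE canonical cyclotomic `p`-adic height over a number field: existence AND uniqueness.** For
`E/ℚ` with globally minimal model `W`, a good ORDINARY prime `p` and a number field `H` with `W ⊗ H`
globally minimal, there is EXACTLY ONE datum `DH : PAdicHeightDataK W p H` with `DH.IsCanonicalCyc`
(Mazur–Tate / Schneider / Mazur–Stein–Tate; sigma-squared form, absolute normalisation; any `p`).
[cite: MazurSteinTate2006, §2.6–2.8 (PDF p. 10 L7 – p. 11 L58)] [cite: MazurTate1991, Thm. 3.1]
[cite: Schneider1982, §1] -/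
theorem existsUnique_isCanonicalCyc (W : WeierstrassCurve ℚ) [W.IsElliptic] [W.IsGloballyMinimal]
    (p : ℕ) [Fact p.Prime] (H : Type) [Field H] [NumberField H] [(W.baseChange H).IsGloballyMinimal]
    (hgood : W.HasGoodReductionAtPrime p) (hord : ¬ (p : ℤ) ∣ W.frobeniusTrace p) :
    ∃! DH : PAdicHeightDataK W p H, DH.IsCanonicalCyc :=
  existsUnique_isCanonicalCyc_of_pair W p H (exists_isMazurTateSigmaSqPair_of_goodOrdinary W p hgood hord)

/-- **Every canonical cyclotomic datum is `Aut(H/ℚ)`-invariant** (`W ⊗ H` globally minimal, `p` good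
ordinary): it coincides with the invariant datum of `exists_isCanonicalCyc_holds` by uniqueness — the
Galois equivariance of Disegni's pairing (1.3.1) for the cyclotomic `ℓ = log_p ∘ χ_cyc`.
[cite: Disegni2017, §1.3.1 (arXiv v3 PDF p. 7 L30–38)] [cite: MazurSteinTate2006, §2.8 (PDF p. 11 L33–58)] -/
theorem PAdicHeightDataK.IsCanonicalCyc.pairing_pointGalHom {W : WeierstrassCurve ℚ} [W.IsElliptic]
    [W.IsGloballyMinimal] {p : ℕ} [Fact p.Prime] {H : Type} [Field H] [NumberField H]
    [(W.baseChange H).IsGloballyMinimal] (hgood : W.HasGoodReductionAtPrime p)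
    (hord : ¬ (p : ℤ) ∣ W.frobeniusTrace p) {DH : PAdicHeightDataK W p H} (hDH : DH.IsCanonicalCyc)
    (σ : H ≃ₐ[ℚ] H) (a b : (W.baseChange H).toAffine.Point) :
    DH.pairing (pointGalHom W H σ a) (pointGalHom W H σ b) = DH.pairing a b := by
  obtain ⟨D₀, hD₀, hinv⟩ := WeierstrassCurve.exists_isCanonicalCyc_holds W p H hgood hord
  have heq : DH = D₀ := (existsUnique_isCanonicalCyc W p H hgood hord).unique hDH hD₀
  subst heq
  exact hinv σ a b

end WeierstrassCurve

end
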